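import Literature.AlgebraicGeometry.Motives.RigidTuplesProofs
import Literature.AlgebraicGeometry.Motives.ConjugateTupleVarietyDimension
import Mathlib.LinearAlgebra.Matrix.ToLin
import Mathlib.LinearAlgebra.Matrix.NonsingularInverse
import Mathlib.Tactic.Group
import HarnessLib

/-!
# Linearly rigid ⟹ index of rigidity `2`; `DettweilerReiter2000_lemma_4_7` discharged

Topic `Literature/AlgebraicGeometry/Motives`.  The remaining direction of Katz's rigidity criterion
for tuples ([DettweilerReiter2000, Lemma 4.7] = [Katz1996, Thm. 1.1.2]; [StrambachVolklein1999]
in all characteristics; [Haraoka2020, Thm. 7.8, third part]): an irreducible LINEARLY RIGID tuple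
`T` in `GL_n(K)`, `K` algebraically closed, with `T_∞ = 1` has `rig(T) ≥ 2` — hence `= 2` by
`RigidTuple.rigidityIndex_le_two`, and the named fact `DettweilerReiter2000_lemma_4_7` of
`RigidTuples.lean` HOLDS (`DettweilerReiter2000_lemma_4_7_holds`).

Proof: choose a basis of `V`; linear rigidity of `ρ` becomes the matrix statement that every
tuple `(Cᵢ)` in `GL_n(K)` with `∏ᵢ Cᵢ Tᵢ Cᵢ⁻¹ = 1` is `(D₀ Wᵢ)` with `Wᵢ ∈ C(Tᵢ)`
(`matrixRigid_of_isLinearlyRigid`: apply `IsLinearlyRigid` to `ρ' : fᵢ ↦ cᵢ ρ(fᵢ) cᵢ⁻¹`); the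
dimension count `RigidTuple.dim_count` of `ConjugateTupleVarietyDimension.lean` then reads
`r n² + 1 ≤ 2 n² + Σᵢ dim C(Tᵢ)`, i.e. `rig(T) ≥ 1` (`rigidityIndex_pos_of_isLinearlyRigid`), and the
index is even (`RigidTuple.even_rigidityIndex`, [Haraoka2020, Prop. 7.7]).

## References
* [StrambachVolklein1999] K. Strambach, H. Völklein, *On linearly rigid tuples*, J. reine angew.
  Math. 510 (1999) 57–62; [Haraoka2020] Thm. 7.8; [Katz1996] Thm. 1.1.2; [DettweilerReiter2000]
  Lemma 4.7.
-/

noncomputable section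

namespace Literature.AlgebraicGeometry.Motives

namespace RigidTuple

open MiddleConvolution Module Matrix

universe u v

variable {K : Type u} [Field K] {V : Type v} [AddCommGroup V] [Module K V] {r : ℕ}

/-! ### Transport to matrices -/

section Transport

variable {n : ℕ} (b : Basis (Fin n) K V)

/-- Centralisers correspond under the algebra isomorphism `End V ≃ M_n(K)` of a basis, so
`dim C(T_i)` may be computed on matrices. [folklore] -/
theorem finrank_centralizer_toMatrixAlgEquiv (A : Module.End K V) :
    finrank K (Subalgebra.centralizer K
      ({LinearMap.toMatrixAlgEquiv b A} : Set (Matrix (Fin n) (Fin n) K))) = centralizerDim A := by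
  unfold centralizerDim
  set e := LinearMap.toMatrixAlgEquiv b with he
  have hmap : (Subalgebra.centralizer K ({A} : Set (Module.End K V))).map e.toAlgHom =
      Subalgebra.centralizer K ({e A} : Set (Matrix (Fin n) (Fin n) K)) := by
    ext M
    rw [Subalgebra.mem_map, Subalgebra.mem_centralizer_iff]
    constructor
    · rintro ⟨B, hB, rfl⟩
      rw [Subalgebra.mem_centralizer_iff] at hB
      intro g hg
      rw [Set.mem_singleton_iff] at hg
      rw [hg]
      change e A * e B = e B * e A
      rw [← map_mul, ← map_mul, hB A rfl]
    · intro hM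
      refine ⟨e.symm M, ?_, e.apply_symm_apply M⟩
      rw [Subalgebra.mem_centralizer_iff]
      intro g hg
      rw [Set.mem_singleton_iff] at hg
      subst hg
      apply e.injective
      rw [map_mul, map_mul, e.apply_symm_apply]
      exact hM (e g) rfl
  rw [← hmap, ← Subalgebra.finrank_toSubmodule, ← Subalgebra.finrank_toSubmodule,
    Subalgebra.map_toSubmodule]
  exact (LinearEquiv.finrank_eq (Submodule.equivMapOfInjective _ e.injective _)).symm

end Transport

/-! ### Linear rigidity in matrix form -/

/-- For an invertible matrix, `adj C = det C • C⁻¹`, so `C T adj C = det C • (C T C⁻¹)`.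
[folklore] -/
theorem mul_mul_adjugate_eq_smul {n : ℕ} (C T : Matrix (Fin n) (Fin n) K)
    (hC : C.det ≠ 0) :
    C * T * C.adjugate = C.det • (C * T * C⁻¹) := by
  rw [Matrix.inv_def, Ring.inverse_eq_inv', Matrix.mul_smul, smul_smul, mul_inv_cancel₀ hC,
    one_smul]

/-- **Linear rigidity of `ρ` in matrix form**: in a basis, with `T_i` the matrix of `ρ(f_i)`, every
tuple `(C_i)` in `GL_n(K)` with `∏ᵢ C_i T_i C_i⁻¹ = 1` is `(D₀ W_i)` with `W_i ∈ C(T_i)` (apply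
`IsLinearlyRigid` to `ρ' : f_i ↦ c_i ρ(f_i) c_i⁻¹`, `c_i ↔ C_i`; if `X ρ = ρ' X` then `D₀ ↔ X`,
`W_i ↔ X⁻¹ c_i`). [cite: DettweilerReiter2000, Definition 4.6] -/
theorem matrixRigid_of_isLinearlyRigid {n : ℕ} (b : Basis (Fin n) K V)
    (ρ : Representation K (FreeGroup (Fin r)) V) (h1 : ρ (prodGenerators r) = 1)
    (hrig : IsLinearlyRigid ρ) (C : Fin r → Matrix (Fin n) (Fin n) K) (hC : ∀ i, (C i).det ≠ 0)
    (hprod : (List.ofFn fun i => C i * LinearMap.toMatrixAlgEquiv b (ρ (FreeGroup.of i)) *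
      (C i).adjugate).prod = (∏ i, (C i).det) • (1 : Matrix (Fin n) (Fin n) K)) :
    ∃ (D₀ : Matrix (Fin n) (Fin n) K) (W : ∀ i, Subalgebra.centralizer K
      ({LinearMap.toMatrixAlgEquiv b (ρ (FreeGroup.of i))} : Set (Matrix (Fin n) (Fin n) K))),
      ∀ i, C i = D₀ * (W i : Matrix (Fin n) (Fin n) K) := by
  set e := LinearMap.toMatrixAlgEquiv b with he
  set T : Fin r → Matrix (Fin n) (Fin n) K := fun i => e (ρ (FreeGroup.of i)) with hT
  -- `∏ᵢ Cᵢ Tᵢ Cᵢ⁻¹ = 1`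
  have hprod' : (List.ofFn fun i => C i * T i * (C i)⁻¹).prod = 1 := by
    have h := hprod
    simp_rw [mul_mul_adjugate_eq_smul (C _) _ (hC _)] at h
    rw [List.ofFn_eq_map, list_prod_map_smul, ← List.ofFn_eq_map, ← List.ofFn_eq_map,
      List.prod_ofFn] at h
    exact smul_right_injective (Matrix (Fin n) (Fin n) K)
      (Finset.prod_ne_zero_iff.2 fun i _ => hC i) h
  -- the units `cᵢ ↔ Cᵢ` of `End V` and the conjugated representation `ρ'`
  have hcu : ∀ i, IsUnit (e.symm (C i)) := fun i =>
    ((Matrix.isUnit_iff_isUnit_det _).2 (isUnit_iff_ne_zero.2 (hC i))).map e.symm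
  set c : Fin r → (Module.End K V)ˣ := fun i => (hcu i).unit with hc
  have hce : ∀ i, e (c i : Module.End K V) = C i := fun i => by
    rw [hc, IsUnit.unit_spec, e.apply_symm_apply]
  set g : Fin r → (Module.End K V)ˣ := fun i => c i * ρ.asGroupHom (FreeGroup.of i) * (c i)⁻¹
    with hg
  set ρ' : Representation K (FreeGroup (Fin r)) V :=
    (Units.coeHom (Module.End K V)).comp (FreeGroup.lift g) with hρ'
  have hρ'of : ∀ i,
      ρ' (FreeGroup.of i) = (c i : Module.End K V) * ρ (FreeGroup.of i) * ↑(c i)⁻¹ := by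
    intro i
    simp [hρ', hg, Representation.asGroupHom_apply]
  have hconj : ∀ i, IsConj (ρ (FreeGroup.of i)) (ρ' (FreeGroup.of i)) := fun i =>
    ⟨c i, by rw [SemiconjBy, hρ'of, Units.inv_mul_cancel_right]⟩
  -- `ρ'(T_∞) = 1`, computed in matrices
  have hinv : ∀ i, e (↑(c i)⁻¹ : Module.End K V) = (C i)⁻¹ := fun i =>
    (Matrix.inv_eq_left_inv (by rw [← hce i, ← map_mul, Units.inv_mul, map_one])).symm
  have hρ'T : ρ' (prodGenerators r) = 1 := by
    apply e.injective
    rw [map_one, prodGenerators, map_list_prod, map_list_prod, List.map_ofFn, List.map_ofFn,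
      ← hprod']
    congr 1
    refine List.ofFn_inj.2 (funext fun i => ?_)
    simp only [Function.comp_apply, hρ'of, map_mul, hce, hinv]
    rfl
  -- rigidity
  obtain ⟨X, hX⟩ := hrig ρ' hconj (by rw [h1, hρ'T])
  -- units-level form of `X ρᵢ = ρ'ᵢ X`
  have hXu : ∀ i, X * ρ.asGroupHom (FreeGroup.of i) =
      c i * ρ.asGroupHom (FreeGroup.of i) * (c i)⁻¹ * X := by
    intro i
    refine Units.ext ?_
    simp only [Units.val_mul, Representation.asGroupHom_apply]
    have h := hX i
    rw [SemiconjBy, hρ'of] at h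
    exact h
  have hkey : ∀ i, c i * ρ.asGroupHom (FreeGroup.of i) * (c i)⁻¹ =
      X * ρ.asGroupHom (FreeGroup.of i) * X⁻¹ := fun i => by
    rw [hXu]; group
  have hcomm : ∀ i, ρ.asGroupHom (FreeGroup.of i) * (X⁻¹ * c i) =
      X⁻¹ * c i * ρ.asGroupHom (FreeGroup.of i) := fun i => by
    symm
    calc X⁻¹ * c i * ρ.asGroupHom (FreeGroup.of i)
        = X⁻¹ * (c i * ρ.asGroupHom (FreeGroup.of i) * (c i)⁻¹) * c i := by group
      _ = X⁻¹ * (X * ρ.asGroupHom (FreeGroup.of i) * X⁻¹) * c i := by rw [hkey]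
      _ = ρ.asGroupHom (FreeGroup.of i) * (X⁻¹ * c i) := by group
  refine ⟨e (X : Module.End K V), fun i => ⟨e (↑(X⁻¹ * c i) : Module.End K V), ?_⟩, fun i => ?_⟩
  · rw [Subalgebra.mem_centralizer_iff]
    intro g hg
    rw [Set.mem_singleton_iff] at hg
    rw [hg, ← map_mul, ← map_mul]
    congr 1
    have := congrArg (fun u : (Module.End K V)ˣ => (u : Module.End K V)) (hcomm i)
    simpa only [Units.val_mul, Representation.asGroupHom_apply] using this
  · change C i = e ↑X * e ↑(X⁻¹ * c i)
    rw [← map_mul, ← Units.val_mul, mul_inv_cancel_left, hce]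

/-! ### The theorem -/

/-- **Linearly rigid ⟹ index of rigidity `> 0`** ([StrambachVolklein1999]; [Haraoka2020, Thm. 7.8,
third part]; Deligne–Simpson): for an irreducible linearly rigid tuple with `T_∞ = 1` over an
algebraically closed field, `rig(T) ≥ 1` — the dimension count `dim_count`
(`r n² + 1 ≤ n² + n² + Σᵢ dim C(Tᵢ)`) read through a basis of `V`.
[cite: StrambachVolklein1999, Theorem] -/
theorem rigidityIndex_pos_of_isLinearlyRigid [IsAlgClosed K] [FiniteDimensional K V]
    (ρ : Representation K (FreeGroup (Fin r)) V) (hirr : ρ.IsIrreducible)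
    (h1 : ρ (prodGenerators r) = 1) (hrig : IsLinearlyRigid ρ) : 0 < rigidityIndex ρ := by
  classical
  haveI := hirr
  -- `V ≠ 0`
  have hnt : Nontrivial V := by
    rw [← Submodule.nontrivial_iff (R := K)]
    refine ⟨⟨⊥, ⊤, fun h => ?_⟩⟩
    exact (bot_ne_top : (⊥ : Subrepresentation ρ) ≠ ⊤)
      (Subrepresentation.toSubmodule_injective (by exact h))
  have hV : 0 < finrank K V := finrank_pos
  set n := finrank K V with hn
  let b : Basis (Fin n) K V := finBasis K V
  set e := LinearMap.toMatrixAlgEquiv b with he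
  set T : Fin r → Matrix (Fin n) (Fin n) K := fun i => e (ρ (FreeGroup.of i)) with hT
  have hTprod : (List.ofFn T).prod = 1 := by
    have h2 : (List.ofFn fun i => ρ (FreeGroup.of i)).prod = ρ (prodGenerators r) := by
      rw [prodGenerators, map_list_prod, List.map_ofFn]
      rfl
    have h := map_list_prod e (List.ofFn fun i => ρ (FreeGroup.of i))
    rw [List.map_ofFn, h2, h1, map_one] at h
    exact h.symm
  have hdim := dim_count T (matrixRigid_of_isLinearlyRigid b ρ h1 hrig) hTprod ⟨0, hV⟩
  have hc : ∀ i, cdim T i = centralizerDim (ρ (FreeGroup.of i)) := fun i =>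
    finrank_centralizer_toMatrixAlgEquiv b _
  simp only [hc] at hdim
  rw [rigidityIndex_eq_of_prodGenerators_eq_one ρ h1]
  have hdim' := (Nat.cast_le (α := ℤ)).2 hdim
  push_cast at hdim'
  rw [← hn]
  nlinarith [hdim']

/-- **[StrambachVolklein1999] / [Haraoka2020, Thm. 7.8]: linearly rigid ⟹ index of rigidity `= 2`**
(here `≥ 2`, the index being `≤ 2` for irreducible tuples and even).
[cite: StrambachVolklein1999, Theorem] -/
theorem two_le_rigidityIndex_of_isLinearlyRigid [IsAlgClosed K] [FiniteDimensional K V]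
    (ρ : Representation K (FreeGroup (Fin r)) V) (hirr : ρ.IsIrreducible)
    (h1 : ρ (prodGenerators r) = 1) (hrig : IsLinearlyRigid ρ) : 2 ≤ rigidityIndex ρ := by
  have h := rigidityIndex_pos_of_isLinearlyRigid ρ hirr h1 hrig
  obtain ⟨k, hk⟩ := even_rigidityIndex ρ
  omega

end RigidTuple

/-- **Dettweiler–Reiter 2000, Lemma 4.7, discharged** (= [Katz1996, Thm. 1.1.2] with
[StrambachVolklein1999]): an irreducible tuple in `GL_n(K)`, `K` algebraically closed, with
`T_∞ = 1` is linearly rigid iff its index of rigidity is `2`.  "⟸" is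
`RigidTuple.isLinearlyRigid_of_rigidityIndex_eq_two` (Scott's lemma); "⟹" is `RigidTuple.two_le_rigidityIndex_of_isLinearlyRigid` (the dimension count
of the variety of conjugate tuples, files `ConjugateTupleVariety*.lean`) with
`RigidTuple.rigidityIndex_le_two`. [cite: DettweilerReiter2000, Lemma 4.7] -/
theorem DettweilerReiter2000_lemma_4_7_holds : DettweilerReiter2000_lemma_4_7 :=
  DettweilerReiter2000_lemma_4_7_iff_pos.2 fun _ _ _ _ _ _ _ _ ρ hirr h1 hrig =>
    RigidTuple.rigidityIndex_pos_of_isLinearlyRigid ρ hirr h1 hrig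

end Literature.AlgebraicGeometry.Motives

end
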